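import Literature.Probability.LatticeModels.WeightedClusterDecomposition
import Literature.Probability.LatticeModels.IsingLaceParity
import Literature.Probability.LatticeModels.IsingLaceThrough
import HarnessLib

/-!
# Sakai's first expansion, step (2.14)–(2.16): conditioning on the cluster `𝒞^b_n(o)`

Topic `Probability/LatticeModels`, grouping namespace `IsingLace`. Third file of the proof
campaign for Sakai 2007, Proposition 1.1 (`IsingLace.Sakai2007_prop11`): "we condition on
`𝒞^b_n(o) = 𝒜` and decouple events occurring on `𝔹_{𝒜ᶜ}` from events occurring on
`𝔹_Λ ∖ 𝔹_{𝒜ᶜ}` … multiplying `Z_{𝒜ᶜ}/Z_{𝒜ᶜ} ≡ 1` … and then summing over `𝒜 ⊂ Λ`" (Sakai 2007,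
(2.14)–(2.16)). Proved here, for a finite graph with uniform coupling `β ≥ 0`, all sums in `ℝ≥0∞`:

* the restricted-state dictionary in `tsum` form (`twoPointOff_eq_tsum_div`, from
  `IsingLaceThrough.lean`): `⟨φ_vφ_x⟩_{𝒜ᶜ} = (Σ_{∂m = v△x, m ⊆ 𝔹_{𝒜ᶜ}} w(m)) / Z_{𝒜ᶜ}` for `v, x ∉ 𝒜`;
* locality of the indicators: `o ⟺ b̲` and the cluster only see the bonds meeting the cluster
  (`isDoublyConn_congr_of_agree`, the tree's `Current.cluster_eq_of_agree`), connections "in `𝒜ᶜ`"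
  only see the bonds off `𝒜` (`connAvoid_congr_of_agree_off`);
* **the conditioning identity** (`conditioning_identity`, the cross-multiplied form of the passage
  from (2.13) to (2.15) at a frozen cluster `𝒜 = S`): for `v, x ∉ S`,
  `(Σ_n 1{∂n = o△x△b̲△b̄, n_b even, o ⟺_{n∖b} b̲, 𝒞^b_n(o) = S, b̄ ⟷_n x in Sᶜ} w(n)) · Z_{Sᶜ}`
  `= (Σ_n 1{∂n = o△b̲, n_b even, o ⟺_{n∖b} b̲, 𝒞^b_n(o) = S} w(n)) · (Σ_{∂m = b̄△x, m ⊆ 𝔹_{Sᶜ}} w(m))`,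
  by the weight-preserving involution `(n, m) ↦ (spliceOff S n m, spliceOff S m n)` of the tree
  (`Current.splice_transfer`, Aizenman's conditioning-on-the-cluster change of variables).

## References

* A. Sakai, *Lace expansion for the Ising model*, Comm. Math. Phys. 272 (2007) 283–344,
  arXiv:math-ph/0510093, §2.2.1, (2.14)–(2.16) [Sakai2007].
* M. Aizenman, Comm. Math. Phys. 86 (1982), §5 (conditioning on clusters) [Aizenman1982].
-/

noncomputable section

open Finset
open scoped symmDiff ENNReal BigOperators

namespace Literature.Probability.LatticeModels

variable {V : Type*} [Fintype V] [DecidableEq V] {G : SimpleGraph V} [DecidableRel G.Adj]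

namespace IsingLace

/-! ## The restricted-state dictionary -/

omit [DecidableEq V] in
/-- The uniform real weight is the tree's `ℝ≥0∞` weight of the constant coupling. [folklore] -/
theorem ofReal_weight_eq_eweight (β : ℝ) (n : Current G) :
    ENNReal.ofReal (Current.weight β n) = Current.eweight (fun _ : G.edgeFinset => β) n := rfl

/-- **The restricted-state dictionary in `tsum` form**: for `v, x ∉ 𝒜`,
`⟨φ_vφ_x⟩_{𝒜ᶜ} = (Σ_{∂m = v△x, m ⊆ 𝔹_{𝒜ᶜ}} w(m)) / Z_{𝒜ᶜ}` (the tree's `twoPointOff_eq_div` and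
`currentSum_offGraph` of `IsingLaceThrough.lean`). [cite: Sakai2007, (2.5)] -/
theorem twoPointOff_eq_tsum_div (β : ℝ) (S : Finset V) {v x : V} (hv : v ∉ S) (hx : x ∉ S) :
    twoPointOff G β S v x =
      (∑' m : Current G, if Current.IsSupp (offGraph G S) m ∧ Current.sources m = ({v} : Finset V) ∆ {x}
          then Current.weight β m else 0) / zOff G β S := by
  rw [twoPointOff_eq_div β hv hx, currentSum_offGraph]

/-! ## Locality of the indicators -/

omit [DecidableEq V] in
/-- Adjacency of the trace graph from a vertex of `S` only sees the current on bonds meeting `S`.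
[folklore] -/
theorem traceAdj_congr_of_agree {N N' : Current G} {S : Finset V}
    (hagree : ∀ e : G.edgeFinset, ¬Current.EdgeOff S (e : Sym2 V) → N' e = N e) {a w : V} (ha : a ∈ S) :
    (Percolation.openGraph N.traced).Adj a w ↔ (Percolation.openGraph N'.traced).Adj a w := by
  rw [Percolation.openGraph_adj, Percolation.openGraph_adj]
  have hno : ¬Current.EdgeOff S (s(a, w) : Sym2 V) := fun ho => (Current.edgeOff_mk.1 ho).1 ha
  constructor
  · rintro ⟨⟨hG, hpos⟩, hne⟩
    refine ⟨⟨hG, ?_⟩, hne⟩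
    rw [hagree ⟨s(a, w), hG⟩ hno]; exact hpos
  · rintro ⟨⟨hG, hpos⟩, hne⟩
    refine ⟨⟨hG, ?_⟩, hne⟩
    rw [← hagree ⟨s(a, w), hG⟩ hno]; exact hpos

/-- **`o ⟺_N u` only sees the bonds meeting the cluster of `o`**: two currents agreeing there are
doubly connected together (`2`-edge-reachability is decided inside the cluster). [folklore] -/
theorem isDoublyConn_congr_of_agree {N N' : Current G} {o u : V} {S : Finset V}
    (hS : Current.cluster N o = S)
    (hagree : ∀ e : G.edgeFinset, ¬Current.EdgeOff S (e : Sym2 V) → N' e = N e) :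
    IsDoublyConn G N o u ↔ IsDoublyConn G N' o u := by
  have hS' : Current.cluster N' o = S := Current.cluster_eq_of_agree hS hagree
  have hoS : o ∈ S := hS ▸ Current.mem_cluster_self N o
  have hin : ∀ a w, a ∈ S → (Percolation.openGraph N.traced).Adj a w → w ∈ S := fun a w ha h => by
    rw [← hS] at ha ⊢; exact Current.mem_cluster_of_adj ha h
  have hin' : ∀ a w, a ∈ S → (Percolation.openGraph N'.traced).Adj a w → w ∈ S := fun a w ha h => by
    rw [← hS'] at ha ⊢; exact Current.mem_cluster_of_adj ha h
  rw [isDoublyConn_iff, isDoublyConn_iff, SimpleGraph.isEdgeReachable_two, SimpleGraph.isEdgeReachable_two]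
  refine forall_congr' fun f => ⟨fun h => ?_, fun h => ?_⟩
  · refine Current.reachable_transfer (P := (· ∈ S)) (fun a w ha hadj => ?_) hoS h
    rw [SimpleGraph.deleteEdges_adj] at hadj ⊢
    exact ⟨⟨(traceAdj_congr_of_agree hagree ha).1 hadj.1, hadj.2⟩, hin a w ha hadj.1⟩
  · refine Current.reachable_transfer (P := (· ∈ S)) (fun a w ha hadj => ?_) hoS h
    rw [SimpleGraph.deleteEdges_adj] at hadj ⊢
    exact ⟨⟨(traceAdj_congr_of_agree hagree ha).2 hadj.1, hadj.2⟩, hin' a w ha hadj.1⟩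

omit [DecidableEq V] in
/-- **`v ⟷_N x in Sᶜ` only sees the bonds off `S`.** [folklore] -/
theorem connAvoid_congr_of_agree_off {N N' : Current G} {S : Finset V} {v x : V}
    (hagree : ∀ e : G.edgeFinset, Current.EdgeOff S (e : Sym2 V) → N' e = N e) :
    ConnAvoid G N S v x ↔ ConnAvoid G N' S v x := by
  have ht : Current.tracedIn (offGraph G S) N' = Current.tracedIn (offGraph G S) N := by
    ext f
    simp only [Current.tracedIn, Set.mem_setOf_eq]
    refine and_congr_right fun hf => ?_
    obtain ⟨hfG, ho⟩ := mem_edgeSet_offGraph.1 hf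
    have h := hagree ⟨f, G.mem_edgeFinset.2 hfG⟩ ho
    change ((⟨f, G.mem_edgeFinset.2 hfG⟩ : G.edgeFinset) : Sym2 V) ∈ N'.traced ↔
      ((⟨f, G.mem_edgeFinset.2 hfG⟩ : G.edgeFinset) : Sym2 V) ∈ N.traced
    rw [Current.mem_traced_iff, Current.mem_traced_iff, h]
  simp only [connAvoid_iff, Current.mem_connIn_iff, ht]

/-! ## Splicing a current with `n_b = 0` reset on a bond meeting `S` -/

/-- Resetting a bond meeting `S` commutes with splicing in the first slot. [folklore] -/
theorem spliceOff_update_left {S : Finset V} (n m : Current G) {b : G.edgeFinset}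
    (hb : ¬Current.EdgeOff S (b : Sym2 V)) :
    Current.spliceOff S (Function.update n b 0) m = Function.update (Current.spliceOff S n m) b 0 := by
  funext e
  by_cases he : e = b
  · subst he
    rw [Function.update_self, Current.spliceOff_apply_of_not_edgeOff _ _ hb, Function.update_self]
  · rw [Function.update_of_ne he]
    by_cases ho : Current.EdgeOff S (e : Sym2 V)
    · rw [Current.spliceOff_apply_of_edgeOff _ _ ho, Current.spliceOff_apply_of_edgeOff _ _ ho]
    · rw [Current.spliceOff_apply_of_not_edgeOff _ _ ho, Current.spliceOff_apply_of_not_edgeOff _ _ ho,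
        Function.update_of_ne he]

/-- Resetting a bond meeting `S` in the second slot is invisible to splicing. [folklore] -/
theorem spliceOff_update_right {S : Finset V} (m n : Current G) {b : G.edgeFinset}
    (hb : ¬Current.EdgeOff S (b : Sym2 V)) :
    Current.spliceOff S m (Function.update n b 0) = Current.spliceOff S m n := by
  funext e
  by_cases ho : Current.EdgeOff S (e : Sym2 V)
  · have hne : e ≠ b := fun h => hb (by rw [← h]; exact ho)
    rw [Current.spliceOff_apply_of_edgeOff _ _ ho, Current.spliceOff_apply_of_edgeOff _ _ ho,
      Function.update_of_ne hne]
  · rw [Current.spliceOff_apply_of_not_edgeOff _ _ ho, Current.spliceOff_apply_of_not_edgeOff _ _ ho]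

/-! ## Source bookkeeping -/

omit [Fintype V] [DecidableRel G.Adj] in
/-- The sources of the four-source constraint inside `S`. [folklore] -/
theorem filter_mem_four {S : Finset V} {o u v x : V} (ho : o ∈ S) (hu : u ∈ S) (hv : v ∉ S) (hx : x ∉ S) :
    (((({o} : Finset V) ∆ {x}) ∆ ({u} ∆ {v})).filter (· ∈ S)) = ({o} : Finset V) ∆ {u} := by
  ext w
  simp only [Finset.mem_filter, Finset.mem_symmDiff, Finset.mem_singleton]
  by_cases hw : w ∈ S
  · have hwv : w ≠ v := fun h => hv (h ▸ hw)
    have hwx : w ≠ x := fun h => hx (h ▸ hw)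
    simp only [hwv, hwx, hw]
    tauto
  · have hwo : w ≠ o := fun h => hw (h ▸ ho)
    have hwu : w ≠ u := fun h => hw (h ▸ hu)
    simp only [hwo, hwu, hw]
    tauto

omit [Fintype V] [DecidableRel G.Adj] in
/-- The sources of the four-source constraint off `S`. [folklore] -/
theorem filter_notMem_four {S : Finset V} {o u v x : V} (ho : o ∈ S) (hu : u ∈ S) (hv : v ∉ S) (hx : x ∉ S) :
    (((({o} : Finset V) ∆ {x}) ∆ ({u} ∆ {v})).filter (· ∉ S)) = ({v} : Finset V) ∆ {x} := by
  ext w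
  simp only [Finset.mem_filter, Finset.mem_symmDiff, Finset.mem_singleton]
  by_cases hw : w ∈ S
  · have hwv : w ≠ v := fun h => hv (h ▸ hw)
    have hwx : w ≠ x := fun h => hx (h ▸ hw)
    simp only [hwv, hwx, hw]
    tauto
  · have hwo : w ≠ o := fun h => hw (h ▸ ho)
    have hwu : w ≠ u := fun h => hw (h ▸ hu)
    simp only [hwo, hwu, hw]
    tauto

omit [Fintype V] [DecidableRel G.Adj] in
/-- The sources of the two-source constraint all lie in `S`. [folklore] -/
theorem filter_two_of_mem {S : Finset V} {o u : V} (ho : o ∈ S) (hu : u ∈ S) :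
    ((({o} : Finset V) ∆ {u}).filter (· ∈ S)) = ({o} : Finset V) ∆ {u} ∧
      ((({o} : Finset V) ∆ {u}).filter (· ∉ S)) = ∅ := by
  constructor
  · refine Finset.filter_true_of_mem fun w hw => ?_
    rcases Current.eq_or_eq_of_mem_symmDiff_singleton hw with rfl | rfl
    · exact ho
    · exact hu
  · refine Finset.filter_false_of_mem fun w hw h => h ?_
    rcases Current.eq_or_eq_of_mem_symmDiff_singleton hw with rfl | rfl
    · exact ho
    · exact hu

omit [Fintype V] [DecidableRel G.Adj] in
/-- The sources of the two-source constraint all lie off `S`. [folklore] -/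
theorem filter_two_of_notMem {S : Finset V} {v x : V} (hv : v ∉ S) (hx : x ∉ S) :
    ((({v} : Finset V) ∆ {x}).filter (· ∉ S)) = ({v} : Finset V) ∆ {x} := by
  refine Finset.filter_true_of_mem fun w hw => ?_
  rcases Current.eq_or_eq_of_mem_symmDiff_singleton hw with rfl | rfl
  · exact hv
  · exact hx

omit [Fintype V] [DecidableRel G.Adj] in
/-- `(o △ u) ∪ (v △ x) = (o △ x) △ (u △ v)` when the first pair lies in `S` and the second off
`S`. [folklore] -/
theorem two_union_two_eq_four {S : Finset V} {o u v x : V} (ho : o ∈ S) (hu : u ∈ S) (hv : v ∉ S) (hx : x ∉ S) :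
    (({o} : Finset V) ∆ {u}) ∪ (({v} : Finset V) ∆ {x}) = (({o} : Finset V) ∆ {x}) ∆ ({u} ∆ {v}) := by
  have hdisj : Disjoint (({o} : Finset V) ∆ {u}) (({v} : Finset V) ∆ {x}) := by
    rw [Finset.disjoint_left]
    intro w hw hw'
    rcases Current.eq_or_eq_of_mem_symmDiff_singleton hw with rfl | rfl
    · rcases Current.eq_or_eq_of_mem_symmDiff_singleton hw' with h | h
      · exact hv (h ▸ ho)
      · exact hx (h ▸ ho)
    · rcases Current.eq_or_eq_of_mem_symmDiff_singleton hw' with h | h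
      · exact hv (h ▸ hu)
      · exact hx (h ▸ hu)
  -- `(o △ u) △ (v △ x) = (o △ x) △ (u △ v)`
  have key : (({o} : Finset V) ∆ {u}) ∆ (({v} : Finset V) ∆ {x}) = (({o} : Finset V) ∆ {x}) ∆ ({u} ∆ {v}) := by
    ext w
    simp only [Finset.mem_symmDiff, Finset.mem_singleton]
    tauto
  rw [← Finset.sup_eq_union, ← hdisj.symmDiff_eq_sup, key]

/-! ## The conditioning identity -/

section Transfer

variable {β : ℝ} {S : Finset V} {o u v x : V} {b : G.edgeFinset}

/-- From `o ⟺_{n∖b} u`: `u ∈ 𝒞^b_n(o)`. [folklore] -/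
theorem mem_clusterOff_of_isDoublyConn {n : Current G} (h : IsDoublyConn G (Function.update n b 0) o u) :
    u ∈ clusterOff G n b o := by
  rw [clusterOff_eq, ← conn_iff_mem_cluster]; exact h.1

/-- **Transfer, forward direction.** If `(n, m)` satisfies the constraints of the left side of the
conditioning identity, then `(spliceOff S n m, spliceOff S m n)` satisfies those of the right side.
[cite: Sakai2007, (2.14)–(2.15)] -/
theorem transfer_forward (hb : (b : Sym2 V) = s(u, v)) (hv : v ∉ S) (hx : x ∉ S) {n m : Current G}
    (hn : Current.sources n = (({o} : Finset V) ∆ {x}) ∆ ({u} ∆ {v}) ∧ Even (n b) ∧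
      IsDoublyConn G (Function.update n b 0) o u ∧ clusterOff G n b o = S ∧ ConnAvoid G n S v x)
    (hm : Current.IsSupp (offGraph G S) m ∧ Current.sources m = ∅) :
    (Current.sources (Current.spliceOff S n m) = ({o} : Finset V) ∆ {u} ∧ Even (Current.spliceOff S n m b) ∧
      IsDoublyConn G (Function.update (Current.spliceOff S n m) b 0) o u ∧
        clusterOff G (Current.spliceOff S n m) b o = S) ∧
    (Current.IsSupp (offGraph G S) (Current.spliceOff S m n) ∧
      Current.sources (Current.spliceOff S m n) = ({v} : Finset V) ∆ {x}) := by
  obtain ⟨hsn, heven, hdc, hcl, -⟩ := hn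
  obtain ⟨hsupp, hsm⟩ := hm
  have huS : u ∈ S := hcl ▸ mem_clusterOff_of_isDoublyConn hdc
  have hbS : ¬Current.EdgeOff S (b : Sym2 V) := fun ho => by
    rw [hb, Current.edgeOff_mk] at ho; exact ho.1 huS
  have hclu : Current.cluster (Function.update n b 0 : Current G) o = S := by rw [← clusterOff_eq]; exact hcl
  have hoS : o ∈ S := hclu ▸ Current.mem_cluster_self _ o
  -- sources of `n` and of `n|_{n_b = 0}` agree (`n_b` even)
  have hsn0 : Current.sources (Function.update n b 0 : Current G) = Current.sources n := by
    have h := sources_eq_symmDiff_update n b hb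
    rw [if_neg (Nat.not_odd_iff_even.2 heven), ← Finset.bot_eq_empty, symmDiff_bot] at h
    exact h.symm
  -- the tree's splice transfer, applied to `n|_{n_b=0}` and `m`
  obtain ⟨hC', hk', hsk', hsn'⟩ := Current.splice_transfer (n₁ := (0 : Current G))
    (n₂ := (Function.update n b 0 : Current G)) (k := m) (x := o) (S := S) (by rwa [zero_add]) hsupp
  rw [zero_add, spliceOff_update_left n m hbS] at hC'
  rw [spliceOff_update_right m n hbS] at hk' hsk'
  rw [spliceOff_update_left n m hbS, hsn0, hsm, Finset.filter_empty, Finset.union_empty] at hsn'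
  rw [hsn0] at hsk'
  have hb' : Current.spliceOff S n m b = n b := Current.spliceOff_apply_of_not_edgeOff _ _ hbS
  have heven' : Even (Current.spliceOff S n m b) := hb' ▸ heven
  refine ⟨⟨?_, heven', ?_, ?_⟩, hk', ?_⟩
  · -- `∂n' = ∂(n'|_{b=0}) = ∂n ∩ S = o △ u`
    have h := sources_eq_symmDiff_update (Current.spliceOff S n m) b hb
    rw [if_neg (Nat.not_odd_iff_even.2 heven'), ← Finset.bot_eq_empty, symmDiff_bot] at h
    rw [h, hsn', hsn, filter_mem_four hoS huS hv hx]
  · -- `o ⟺ u` in `n'|_{b=0} = spliceOff S (n|_{b=0}) m`, which agrees with `n|_{b=0}` on bonds meeting `S`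
    rw [← spliceOff_update_left n m hbS]
    refine (isDoublyConn_congr_of_agree hclu fun e he => ?_).1 hdc
    exact Current.spliceOff_apply_of_not_edgeOff _ _ he
  · rw [clusterOff_eq]; exact hC'
  · rw [hsk', hsn, filter_notMem_four hoS huS hv hx]

/-- **Transfer, backward direction.** If `(n, m)` satisfies the constraints of the right side, then
`(spliceOff S n m, spliceOff S m n)` satisfies those of the left side (in particular
`b̄ ⟷ x in Sᶜ` holds automatically: the sources `b̄ △ x` of the outer current force the connection,
`Current.add_mem_connIn_of_sources_eq`). [cite: Sakai2007, (2.14)–(2.15)] -/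
theorem transfer_backward (hb : (b : Sym2 V) = s(u, v)) (hv : v ∉ S) (hx : x ∉ S) {n m : Current G}
    (hn : Current.sources n = ({o} : Finset V) ∆ {u} ∧ Even (n b) ∧
      IsDoublyConn G (Function.update n b 0) o u ∧ clusterOff G n b o = S)
    (hm : Current.IsSupp (offGraph G S) m ∧ Current.sources m = ({v} : Finset V) ∆ {x}) :
    (Current.sources (Current.spliceOff S n m) = (({o} : Finset V) ∆ {x}) ∆ ({u} ∆ {v}) ∧
      Even (Current.spliceOff S n m b) ∧
      IsDoublyConn G (Function.update (Current.spliceOff S n m) b 0) o u ∧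
        clusterOff G (Current.spliceOff S n m) b o = S ∧ ConnAvoid G (Current.spliceOff S n m) S v x) ∧
    (Current.IsSupp (offGraph G S) (Current.spliceOff S m n) ∧
      Current.sources (Current.spliceOff S m n) = ∅) := by
  obtain ⟨hsn, heven, hdc, hcl⟩ := hn
  obtain ⟨hsupp, hsm⟩ := hm
  have huS : u ∈ S := hcl ▸ mem_clusterOff_of_isDoublyConn hdc
  have hbS : ¬Current.EdgeOff S (b : Sym2 V) := fun ho => by
    rw [hb, Current.edgeOff_mk] at ho; exact ho.1 huS
  have hclu : Current.cluster (Function.update n b 0 : Current G) o = S := by rw [← clusterOff_eq]; exact hcl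
  have hoS : o ∈ S := hclu ▸ Current.mem_cluster_self _ o
  have hsn0 : Current.sources (Function.update n b 0 : Current G) = Current.sources n := by
    have h := sources_eq_symmDiff_update n b hb
    rw [if_neg (Nat.not_odd_iff_even.2 heven), ← Finset.bot_eq_empty, symmDiff_bot] at h
    exact h.symm
  obtain ⟨hC', hk', hsk', hsn'⟩ := Current.splice_transfer (n₁ := (0 : Current G))
    (n₂ := (Function.update n b 0 : Current G)) (k := m) (x := o) (S := S) (by rwa [zero_add]) hsupp
  rw [zero_add, spliceOff_update_left n m hbS] at hC'
  rw [spliceOff_update_right m n hbS] at hk' hsk'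
  rw [spliceOff_update_left n m hbS, hsn0, hsm, hsn, (filter_two_of_mem hoS huS).1,
    filter_two_of_notMem hv hx, two_union_two_eq_four hoS huS hv hx] at hsn'
  rw [hsn0, hsn, (filter_two_of_mem hoS huS).2] at hsk'
  have hb' : Current.spliceOff S n m b = n b := Current.spliceOff_apply_of_not_edgeOff _ _ hbS
  have heven' : Even (Current.spliceOff S n m b) := hb' ▸ heven
  refine ⟨⟨?_, heven', ?_, ?_, ?_⟩, hk', hsk'⟩
  · have h := sources_eq_symmDiff_update (Current.spliceOff S n m) b hb
    rw [if_neg (Nat.not_odd_iff_even.2 heven'), ← Finset.bot_eq_empty, symmDiff_bot] at h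
    rw [h, hsn']
  · rw [← spliceOff_update_left n m hbS]
    refine (isDoublyConn_congr_of_agree hclu fun e he => ?_).1 hdc
    exact Current.spliceOff_apply_of_not_edgeOff _ _ he
  · rw [clusterOff_eq]; exact hC'
  · -- the outer part of `spliceOff S n m` is `m`, whose sources `v △ x` force `v ⟷ x` off `S`
    refine (connAvoid_congr_of_agree_off (N := m) fun e he => Current.spliceOff_apply_of_edgeOff _ _ he).1 ?_
    refine connAvoid_iff.2 ⟨hv, hx, ?_⟩
    have h := Current.add_mem_connIn_of_sources_eq (offGraph G S) hsupp hsm 0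
    rwa [add_zero] at h

end Transfer

open Classical in
/-- **The conditioning identity** (the passage (2.13) → (2.15) at a frozen cluster
`𝒞^b_n(o) = S`, cross-multiplied by `Z_{Sᶜ}`): for `β ≥ 0`, `b = s(u, v)` and `v, x ∉ S`,
`(Σ_n 1{∂n = o△x△u△v, n_b even, o ⟺_{n∖b} u, 𝒞^b_n(o) = S, v ⟷_n x in Sᶜ} w(n)) · Z_{Sᶜ}`
`= (Σ_n 1{∂n = o△u, n_b even, o ⟺_{n∖b} u, 𝒞^b_n(o) = S} w(n)) · Σ_{∂m = v△x, m ⊆ 𝔹_{Sᶜ}} w(m)`.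
[cite: Sakai2007, (2.14)–(2.15)] -/
theorem conditioning_identity {β : ℝ} (hβ : 0 ≤ β) {S : Finset V} {o u v x : V} (b : G.edgeFinset)
    (hb : (b : Sym2 V) = s(u, v)) (hv : v ∉ S) (hx : x ∉ S) :
    (∑' n : Current G, if Current.sources n = (({o} : Finset V) ∆ {x}) ∆ ({u} ∆ {v}) ∧ Even (n b) ∧
        IsDoublyConn G (Function.update n b 0) o u ∧ clusterOff G n b o = S ∧ ConnAvoid G n S v x
        then ENNReal.ofReal (Current.weight β n) else 0) *
      (∑' m : Current G, if Current.IsSupp (offGraph G S) m ∧ Current.sources m = ∅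
        then ENNReal.ofReal (Current.weight β m) else 0) =
    (∑' n : Current G, if Current.sources n = ({o} : Finset V) ∆ {u} ∧ Even (n b) ∧
        IsDoublyConn G (Function.update n b 0) o u ∧ clusterOff G n b o = S
        then ENNReal.ofReal (Current.weight β n) else 0) *
      (∑' m : Current G, if Current.IsSupp (offGraph G S) m ∧ Current.sources m = ({v} : Finset V) ∆ {x}
        then ENNReal.ofReal (Current.weight β m) else 0) := by
  have hK : ∀ _e : G.edgeFinset, 0 ≤ β := fun _ => hβ
  -- predicates
  set PA : Current G × Current G → Prop := fun q =>
    (Current.sources q.1 = (({o} : Finset V) ∆ {x}) ∆ ({u} ∆ {v}) ∧ Even (q.1 b) ∧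
      IsDoublyConn G (Function.update q.1 b 0) o u ∧ clusterOff G q.1 b o = S ∧ ConnAvoid G q.1 S v x) ∧
    (Current.IsSupp (offGraph G S) q.2 ∧ Current.sources q.2 = ∅) with hPA
  set PB : Current G × Current G → Prop := fun q =>
    (Current.sources q.1 = ({o} : Finset V) ∆ {u} ∧ Even (q.1 b) ∧
      IsDoublyConn G (Function.update q.1 b 0) o u ∧ clusterOff G q.1 b o = S) ∧
    (Current.IsSupp (offGraph G S) q.2 ∧ Current.sources q.2 = ({v} : Finset V) ∆ {x}) with hPB
  set W : Current G × Current G → ℝ≥0∞ := fun q =>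
    ENNReal.ofReal (Current.weight β q.1) * ENNReal.ofReal (Current.weight β q.2) with hW
  -- both sides as sums over pairs
  rw [tsum_mul_tsum_eq_tsum_prod, tsum_mul_tsum_eq_tsum_prod]
  have hL : ∀ q : Current G × Current G,
      (if Current.sources q.1 = (({o} : Finset V) ∆ {x}) ∆ ({u} ∆ {v}) ∧ Even (q.1 b) ∧
          IsDoublyConn G (Function.update q.1 b 0) o u ∧ clusterOff G q.1 b o = S ∧ ConnAvoid G q.1 S v x
          then ENNReal.ofReal (Current.weight β q.1) else 0) *
        (if Current.IsSupp (offGraph G S) q.2 ∧ Current.sources q.2 = ∅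
          then ENNReal.ofReal (Current.weight β q.2) else 0) =
      if PA q then W q else 0 := fun q => by
    simp only [hPA, hW]
    split_ifs <;> simp_all
  have hR : ∀ q : Current G × Current G,
      (if Current.sources q.1 = ({o} : Finset V) ∆ {u} ∧ Even (q.1 b) ∧
          IsDoublyConn G (Function.update q.1 b 0) o u ∧ clusterOff G q.1 b o = S
          then ENNReal.ofReal (Current.weight β q.1) else 0) *
        (if Current.IsSupp (offGraph G S) q.2 ∧ Current.sources q.2 = ({v} : Finset V) ∆ {x}
          then ENNReal.ofReal (Current.weight β q.2) else 0) =
      if PB q then W q else 0 := fun q => by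
    simp only [hPB, hW]
    split_ifs <;> simp_all
  rw [tsum_congr hL, tsum_congr hR]
  -- the involution
  set f : Current G × Current G → Current G × Current G :=
    fun q => (Current.spliceOff S q.1 q.2, Current.spliceOff S q.2 q.1) with hf
  have hinv : Function.Involutive f := by
    rintro ⟨n, m⟩
    simp only [hf, Current.spliceOff_spliceOff]
  have hWf : ∀ q, W (f q) = W q := by
    rintro ⟨n, m⟩
    simp only [hW, hf, ofReal_weight_eq_eweight]
    exact Current.eweight_spliceOff_mul_eweight_spliceOff hK S n m
  have hAB : ∀ q, PA q → PB (f q) := by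
    rintro ⟨n, m⟩ ⟨hn, hm⟩
    exact transfer_forward hb hv hx hn hm
  have hBA : ∀ q, PB q → PA (f q) := by
    rintro ⟨n, m⟩ ⟨hn, hm⟩
    exact transfer_backward hb hv hx hn hm
  rw [← (hinv.toPerm f).tsum_eq (fun q => if PB q then W q else 0)]
  refine tsum_congr fun q => ?_
  change (if PA q then W q else 0) = (if PB (f q) then W (f q) else 0)
  by_cases hA : PA q
  · rw [if_pos hA, if_pos (hAB q hA), hWf]
  · have hB : ¬PB (f q) := fun hB => hA (by simpa [hinv q] using hBA (f q) hB)
    rw [if_neg hA, if_neg hB]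

end IsingLace

end Literature.Probability.LatticeModels

end
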